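import Literature.NumberTheory.Sieve.FordMaynardSieveBoundG1
import Literature.NumberTheory.Sieve.FordMaynardLambdaVec
import HarnessLib

/-!
# Route `FordMaynardSieveConst01651`, target `SieveConst01651` (stmt-Parity-19185), stub `stub_coneCertClosed`,
# conjunct (i): an algebra of piecewise-constant representations on the ordered cone

Def-free helper file.  Conjunct (i) of `stub_coneCertClosed` is `IsPiecewiseConstOnCone g₀`: in every dimension `k`,
`g₀,ₖ` agrees on the ordered cone with a finite sum `∑ⱼ cⱼ 𝟙[Pⱼ]` of indicators of convex polytopes `Pⱼ ⊆ {monotone}`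
(Ford–Maynard, Definition 7.2 sub-class).  The witness `coneCert` (`…Witness`) is by construction a finite sum of such
indicators (table pieces = open box ∩ band ∩ cone with the table value; face pieces = region ∩ hyperplane with `−64`).
This file supplies the ALGEBRA that turns "by construction" into a proof, for a fixed dimension `k` and the representation
predicate written out (no new definition):

  `Rep k f :≡ ∃ m (P : Fin m → Set (Fin k → ℝ)) (c : Fin m → ℝ), (∀ j, IsConvexPolytope (P j) ∧ P j ⊆ {x | Monotone x})
             ∧ ∀ x, Monotone x → f x = ∑ j, if x ∈ P j then c j else 0`

* `coneRep_zero`, `coneRep_indicator` (one polytope in the cone), `coneRep_congr` (agree on the cone),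
  `coneRep_const_mul`, `coneRep_add`, `coneRep_finset_sum`;
* `isPiecewiseConstOnCone_of_coneRep` — `(∀ k, Rep k (g k)) → IsPiecewiseConstOnCone g` (definitional);
* polytope tools: `isConvexPolytope_inter_cone` (a polytope cut by the cone constraints `xᵢ ≤ xᵢ₊₁` stays a polytope and
  lands in `{monotone}`), via the tree's `isConvexPolytope_of_constraints`.

References: [FordMaynard2024PrimeSieves] arXiv:2407.14368, Definitions 5.7, 7.2.
-/

noncomputable section

open Finset
open scoped Classical
open Literature.NumberTheory.Sieve Literature.NumberTheory.Sieve.FordMaynard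

namespace Summit.Parity.GeneralizedHardyLittlewood.FordMaynardSieveConst01651SieveConst01651

/-! ### The representation algebra (fixed dimension `k`) -/

/-- `Rep k 0` (no pieces). [cite: FordMaynard2024PrimeSieves, Definition 7.2] -/
theorem coneRep_zero (k : ℕ) :
    ∃ (m : ℕ) (P : Fin m → Set (Fin k → ℝ)) (c : Fin m → ℝ),
      (∀ j, IsConvexPolytope (P j) ∧ P j ⊆ {x | Monotone x}) ∧
        ∀ x : Fin k → ℝ, Monotone x → (0 : ℝ) = ∑ j, if x ∈ P j then c j else 0 :=
  ⟨0, Fin.elim0, Fin.elim0, fun j => Fin.elim0 j, fun x _ => by simp⟩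

/-- `Rep k (a·𝟙[Q])` for one convex polytope `Q` in the cone. [cite: FordMaynard2024PrimeSieves, Definition 7.2] -/
theorem coneRep_indicator {k : ℕ} {Q : Set (Fin k → ℝ)} (hQ : IsConvexPolytope Q) (hQc : Q ⊆ {x | Monotone x})
    (a : ℝ) :
    ∃ (m : ℕ) (P : Fin m → Set (Fin k → ℝ)) (c : Fin m → ℝ),
      (∀ j, IsConvexPolytope (P j) ∧ P j ⊆ {x | Monotone x}) ∧
        ∀ x : Fin k → ℝ, Monotone x → (if x ∈ Q then a else 0) = ∑ j, if x ∈ P j then c j else 0 :=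
  ⟨1, fun _ => Q, fun _ => a, fun _ => ⟨hQ, hQc⟩, fun x _ => by simp⟩

/-- `Rep` only sees the cone: functions agreeing on monotone vectors have the same representations.
[cite: FordMaynard2024PrimeSieves, Definition 7.2] -/
theorem coneRep_congr {k : ℕ} {f g : (Fin k → ℝ) → ℝ} (hfg : ∀ x, Monotone x → f x = g x)
    (hf : ∃ (m : ℕ) (P : Fin m → Set (Fin k → ℝ)) (c : Fin m → ℝ),
      (∀ j, IsConvexPolytope (P j) ∧ P j ⊆ {x | Monotone x}) ∧
        ∀ x : Fin k → ℝ, Monotone x → f x = ∑ j, if x ∈ P j then c j else 0) :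
    ∃ (m : ℕ) (P : Fin m → Set (Fin k → ℝ)) (c : Fin m → ℝ),
      (∀ j, IsConvexPolytope (P j) ∧ P j ⊆ {x | Monotone x}) ∧
        ∀ x : Fin k → ℝ, Monotone x → g x = ∑ j, if x ∈ P j then c j else 0 := by
  obtain ⟨m, P, c, hP, hf⟩ := hf
  exact ⟨m, P, c, hP, fun x hx => (hfg x hx) ▸ hf x hx⟩

/-- `Rep k f → Rep k (a·f)` (scale the constants). [cite: FordMaynard2024PrimeSieves, Definition 7.2] -/
theorem coneRep_const_mul {k : ℕ} {f : (Fin k → ℝ) → ℝ} (a : ℝ)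
    (hf : ∃ (m : ℕ) (P : Fin m → Set (Fin k → ℝ)) (c : Fin m → ℝ),
      (∀ j, IsConvexPolytope (P j) ∧ P j ⊆ {x | Monotone x}) ∧
        ∀ x : Fin k → ℝ, Monotone x → f x = ∑ j, if x ∈ P j then c j else 0) :
    ∃ (m : ℕ) (P : Fin m → Set (Fin k → ℝ)) (c : Fin m → ℝ),
      (∀ j, IsConvexPolytope (P j) ∧ P j ⊆ {x | Monotone x}) ∧
        ∀ x : Fin k → ℝ, Monotone x → a * f x = ∑ j, if x ∈ P j then c j else 0 := by
  obtain ⟨m, P, c, hP, hf⟩ := hf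
  refine ⟨m, P, fun j => a * c j, hP, fun x hx => ?_⟩
  rw [hf x hx, Finset.mul_sum]
  refine Finset.sum_congr rfl fun j _ => ?_
  split_ifs <;> simp

/-- `Rep k f → Rep k g → Rep k (f + g)` (concatenate the two families of pieces).
[cite: FordMaynard2024PrimeSieves, Definition 7.2] -/
theorem coneRep_add {k : ℕ} {f g : (Fin k → ℝ) → ℝ}
    (hf : ∃ (m : ℕ) (P : Fin m → Set (Fin k → ℝ)) (c : Fin m → ℝ),
      (∀ j, IsConvexPolytope (P j) ∧ P j ⊆ {x | Monotone x}) ∧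
        ∀ x : Fin k → ℝ, Monotone x → f x = ∑ j, if x ∈ P j then c j else 0)
    (hg : ∃ (m : ℕ) (P : Fin m → Set (Fin k → ℝ)) (c : Fin m → ℝ),
      (∀ j, IsConvexPolytope (P j) ∧ P j ⊆ {x | Monotone x}) ∧
        ∀ x : Fin k → ℝ, Monotone x → g x = ∑ j, if x ∈ P j then c j else 0) :
    ∃ (m : ℕ) (P : Fin m → Set (Fin k → ℝ)) (c : Fin m → ℝ),
      (∀ j, IsConvexPolytope (P j) ∧ P j ⊆ {x | Monotone x}) ∧
        ∀ x : Fin k → ℝ, Monotone x → f x + g x = ∑ j, if x ∈ P j then c j else 0 := by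
  obtain ⟨m₁, P₁, c₁, hP₁, hf⟩ := hf
  obtain ⟨m₂, P₂, c₂, hP₂, hg⟩ := hg
  refine ⟨m₁ + m₂, Fin.append P₁ P₂, Fin.append c₁ c₂, fun j => ?_, fun x hx => ?_⟩
  · refine Fin.addCases (fun i => ?_) (fun i => ?_) j
    · simp only [Fin.append_left]; exact hP₁ i
    · simp only [Fin.append_right]; exact hP₂ i
  · rw [hf x hx, hg x hx, Fin.sum_univ_add]
    simp only [Fin.append_left, Fin.append_right]

/-- `Rep` is closed under finite sums. [cite: FordMaynard2024PrimeSieves, Definition 7.2] -/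
theorem coneRep_finset_sum {k : ℕ} {ι : Type*} (s : Finset ι) (f : ι → (Fin k → ℝ) → ℝ)
    (h : ∀ i ∈ s, ∃ (m : ℕ) (P : Fin m → Set (Fin k → ℝ)) (c : Fin m → ℝ),
      (∀ j, IsConvexPolytope (P j) ∧ P j ⊆ {x | Monotone x}) ∧
        ∀ x : Fin k → ℝ, Monotone x → f i x = ∑ j, if x ∈ P j then c j else 0) :
    ∃ (m : ℕ) (P : Fin m → Set (Fin k → ℝ)) (c : Fin m → ℝ),
      (∀ j, IsConvexPolytope (P j) ∧ P j ⊆ {x | Monotone x}) ∧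
        ∀ x : Fin k → ℝ, Monotone x → ∑ i ∈ s, f i x = ∑ j, if x ∈ P j then c j else 0 := by
  induction s using Finset.induction_on with
  | empty =>
      obtain ⟨m, P, c, hP, h0⟩ := coneRep_zero k
      exact ⟨m, P, c, hP, fun x hx => by rw [Finset.sum_empty]; exact h0 x hx⟩
  | insert a s ha ih =>
      have hrest := ih (fun i hi => h i (Finset.mem_insert_of_mem hi))
      have hhead := h a (Finset.mem_insert_self a s)
      obtain ⟨m, P, c, hP, hsum⟩ := coneRep_add hhead hrest
      exact ⟨m, P, c, hP, fun x hx => by rw [Finset.sum_insert ha]; exact hsum x hx⟩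

/-- From representations in every dimension to `IsPiecewiseConstOnCone` (definitional repackaging).
[cite: FordMaynard2024PrimeSieves, Definition 7.2] -/
theorem isPiecewiseConstOnCone_of_coneRep (g : VecFn)
    (h : ∀ k : ℕ, ∃ (m : ℕ) (P : Fin m → Set (Fin k → ℝ)) (c : Fin m → ℝ),
      (∀ j, IsConvexPolytope (P j) ∧ P j ⊆ {x | Monotone x}) ∧
        ∀ x : Fin k → ℝ, Monotone x → g k x = ∑ j, if x ∈ P j then c j else 0) :
    IsPiecewiseConstOnCone g := h

/-! ### Polytopes cut by the cone -/

/-- The ordered cone `{x₁ ≤ ⋯ ≤ x_k}` in terms of successive differences. [folklore] -/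
theorem monotone_iff_succ {k : ℕ} (x : Fin k → ℝ) :
    Monotone x ↔ ∀ i : Fin k, ∀ h : (i : ℕ) + 1 < k, x i ≤ x ⟨(i : ℕ) + 1, h⟩ := by
  constructor
  · intro hx i h
    exact hx (Fin.le_iff_val_le_val.2 (by simp))
  · intro h
    refine monotone_nat_of_le_succ' ?_
    intro i hi
    exact h i hi
where
  /-- helper: a function on `Fin k` that is non-decreasing at every successor step is monotone. [folklore] -/
  monotone_nat_of_le_succ' {k : ℕ} {x : Fin k → ℝ}
      (h : ∀ i : Fin k, ∀ hi : (i : ℕ) + 1 < k, x i ≤ x ⟨(i : ℕ) + 1, hi⟩) : Monotone x := by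
    intro a b hab
    -- induct on the gap `b - a`
    obtain ⟨a, ha⟩ := a
    obtain ⟨b, hb⟩ := b
    simp only [Fin.le_iff_val_le_val] at hab
    induction b, hab using Nat.le_induction with
    | base => exact le_rfl
    | succ n hn ih =>
        have hn' : n < k := by omega
        exact (ih hn').trans (h ⟨n, hn'⟩ hb)

/-- **A convex polytope cut by the cone is a convex polytope inside the cone.** For a convex polytope `Q ⊆ ℝ^k`, the
set `Q ∩ {x | Monotone x}` is again a convex polytope (add the `k − 1` non-strict constraints `xᵢ − xᵢ₊₁ ≤ 0`) and lies
in the cone. [cite: FordMaynard2024PrimeSieves, Definitions 5.7 and 7.2] -/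
theorem isConvexPolytope_inter_cone {k : ℕ} {Q : Set (Fin k → ℝ)} (hQ : IsConvexPolytope Q) :
    IsConvexPolytope (Q ∩ {x | Monotone x}) ∧ Q ∩ {x | Monotone x} ⊆ {x | Monotone x} := by
  refine ⟨?_, Set.inter_subset_right⟩
  obtain ⟨hB, S, T, hQ⟩ := hQ
  -- index the old constraints by the subtypes of `S`, `T` and the new ones by `Fin k`
  -- (for `i` with `i+1 < k`: `x i - x (i+1) ≤ 0`; otherwise the vacuous `0 ≤ 0`)
  let a₂ : (T ⊕ Fin k) → Fin k → ℝ := fun s => match s with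
    | Sum.inl c => c.1.1
    | Sum.inr i => if h : (i : ℕ) + 1 < k then (fun l => if l = i then 1 else if l = ⟨(i : ℕ) + 1, h⟩ then -1 else 0)
        else fun _ => 0
  let b₂ : (T ⊕ Fin k) → ℝ := fun s => match s with
    | Sum.inl c => c.1.2
    | Sum.inr _ => 0
  refine isConvexPolytope_of_constraints (ι₁ := S) (ι₂ := T ⊕ Fin k) (fun c => c.1.1) (fun c => c.1.2) a₂ b₂
    (hB.subset Set.inter_subset_left) fun x => ?_
  rw [Set.mem_inter_iff, hQ, Set.mem_setOf_eq, Set.mem_setOf_eq, monotone_iff_succ]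
  constructor
  · rintro ⟨⟨hS, hT⟩, hmono⟩
    refine ⟨fun c => hS c.1 c.2, fun s => ?_⟩
    rcases s with c | i
    · exact hT c.1 c.2
    · simp only [a₂, b₂]
      split_ifs with h
      · have key : ∑ l, (if l = i then (1 : ℝ) else if l = ⟨(i : ℕ) + 1, h⟩ then -1 else 0) * x l =
            x i - x ⟨(i : ℕ) + 1, h⟩ := by
          have hne : (⟨(i : ℕ) + 1, h⟩ : Fin k) ≠ i := by
            intro he; have := congrArg Fin.val he; simp at this
          rw [Finset.sum_eq_add_of_mem i ⟨(i : ℕ) + 1, h⟩ (Finset.mem_univ _) (Finset.mem_univ _) hne.symm]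
          · simp [hne]; ring
          · intro l _ hl
            rcases hl with ⟨hl1, hl2⟩
            simp [hl1, hl2]
        rw [key]; linarith [hmono i h]
      · simp
  · rintro ⟨hS, hT⟩
    refine ⟨⟨fun c hc => hS ⟨c, hc⟩, fun c hc => hT (Sum.inl ⟨c, hc⟩)⟩, fun i h => ?_⟩
    have := hT (Sum.inr i)
    simp only [a₂, b₂, dif_pos h] at this
    have key : ∑ l, (if l = i then (1 : ℝ) else if l = ⟨(i : ℕ) + 1, h⟩ then -1 else 0) * x l =
        x i - x ⟨(i : ℕ) + 1, h⟩ := by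
      have hne : (⟨(i : ℕ) + 1, h⟩ : Fin k) ≠ i := by
        intro he; have := congrArg Fin.val he; simp at this
      rw [Finset.sum_eq_add_of_mem i ⟨(i : ℕ) + 1, h⟩ (Finset.mem_univ _) (Finset.mem_univ _) hne.symm]
      · simp [hne]; ring
      · intro l _ hl
        rcases hl with ⟨hl1, hl2⟩
        simp [hl1, hl2]
    rw [key] at this; linarith

end Summit.Parity.GeneralizedHardyLittlewood.FordMaynardSieveConst01651SieveConst01651

end
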